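import Summits.KontsevichZagierPeriods.KontsevichZagierPeriods.Theorems.SymplecticScissorsRealOnePeriodRelationsStubRetractionConcatAux
import Summits.KontsevichZagierPeriods.KontsevichZagierPeriods.Theorems.SymplecticScissorsRealOnePeriodRelationsStubSaPathSubsetAux
import Literature.NumberTheory.Transcendental.CurvePeriodsContinuousTrianglesProofs

/-!
# `RealOnePeriodRelations` (stmt-KontsevichZagierPeriods-10042), line `nash-retraction-thin-strip`:
# concatenation of paths in the move world (helper file for the stub `stub_retraction`)

The retraction `Θ` kills Huber–Wüstholz's boundary relation (R5)
`(Z, ω, e₀₁) + (Z, ω, e₁₂) − (Z, ω, e₀₂) ∼ 0` of a triangle `τ` by passing through the `C¹`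
CONCATENATION `e₀₁ ⋆ e₁₂` (`CurvePeriods.CurvePath.concat`, glued with the flat cubic
`φ(t) = 3t² − 2t³`, a POLYNOMIAL — so concatenations of semialgebraic paths are semialgebraic,
`helper_saPathSubset_1` of the sibling file `…StubSaPathSubsetAux`):

* §1 `[∫ along γ₁ ⋆ γ₂] ≡ [∫ along γ₁] + [∫ along γ₂] (mod M₁)`: split the unit interval at `1/2`
  (rule 1a; the point `{1/2}` is null) and reparametrise each half onto `(0,1)` by `φ(2t)`,
  `φ(2t − 1)` (rule 2 in dimension one) — the ingredients are in the auxiliary file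
  `…StubRetractionConcatAux`;
* §2 the unit path `t ↦ t` of `𝔸¹` is semialgebraic;
* §3 homotopies: `γ₁ ≃ γ₁′`, `γ₂ ≃ γ₂′ ⟹ γ₁ ⋆ γ₂ ≃ γ₁′ ⋆ γ₂′` (`Path.Homotopic.hcomp` through
  `CurvePeriods.exists_path_concat`), and the edges of a CONTINUOUS triangle satisfy
  `e₀₂ ≃ e₀₁ ⋆ e₁₂` (the homotopy of `CurvePeriods.span_boundary_of_continuousTriangle`).

References: A. Huber, G. Wüstholz, *Transcendence and Linear Relations of 1-Periods* (2022),
§3.3.1; M. Kontsevich, D. Zagier, *Periods* (2001), §1.2.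
-/

noncomputable section

open scoped BigOperators unitInterval
open Set MeasureTheory MvPolynomial
open Literature.NumberTheory.Transcendental Literature.NumberTheory.Transcendental.CurvePeriods
open Literature.ModelTheory.ExponentialFields (IsSemialgebraic)
open Summit.KontsevichZagierPeriods.SymplecticScissors.RealOnePeriodRelationsNegative (M₁ unitDom)
open Summit.KontsevichZagierPeriods.HermiteRigidity.GenusTwoCycleTransfer (stub_pushforwardDimOne
  stub_semialgebraicInvFunOn)

namespace Summit.KontsevichZagierPeriods.SymplecticScissors.RealOnePeriodRelations

namespace RetractionConcat

variable {Z : CurveData}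

/-! ## §1 Concatenation in the move world -/

/-- **`[∫ along γ₁ ⋆ γ₂] ≡ [∫ along γ₁] + [∫ along γ₂] (mod M₁)`**: realisations `r`, `r₁`, `r₂` of
`b·ω` along `γ₁ ⋆ γ₂`, `γ₁`, `γ₂` satisfy `[r] − [r₁] − [r₂] ∈ M₁`. [cite: KontsevichZagier2001, §1.2] -/
theorem concat_move (γ₁ γ₂ : CurvePath Z) (hj : γ₁.toFun 1 = γ₂.toFun 0)
    (ω : Fin Z.n → MvPolynomial (Fin Z.n) ℂ) (b : ℂ) (r r₁ r₂ : KZ.IntegralRep 1)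
    (hr : r.domain = {z | z 0 ∈ Set.Ioo (0 : ℝ) 1} ∧ ∀ z ∈ r.domain, r.integrand z =
      (b * ∑ i, MvPolynomial.eval ((γ₁.concat γ₂ hj).toFun (z 0)) (ω i) *
        deriv (fun u => (γ₁.concat γ₂ hj).toFun u i) (z 0)).re)
    (hr₁ : r₁.domain = {z | z 0 ∈ Set.Ioo (0 : ℝ) 1} ∧ ∀ z ∈ r₁.domain, r₁.integrand z =
      (b * ∑ i, MvPolynomial.eval (γ₁.toFun (z 0)) (ω i) * deriv (fun u => γ₁.toFun u i) (z 0)).re)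
    (hr₂ : r₂.domain = {z | z 0 ∈ Set.Ioo (0 : ℝ) 1} ∧ ∀ z ∈ r₂.domain, r₂.integrand z =
      (b * ∑ i, MvPolynomial.eval (γ₂.toFun (z 0)) (ω i) * deriv (fun u => γ₂.toFun u i) (z 0)).re) :
    KZ.of r - KZ.of r₁ - KZ.of r₂ ∈ M₁ := by
  have hA : {z : Fin 1 → ℝ | z 0 ∈ Set.Ioo (0 : ℝ) (1 / 2)} ⊆ r.domain := fun z hz => by
    rw [hr.1]; exact ⟨hz.1, by linarith [hz.2]⟩
  have hB : {z : Fin 1 → ℝ | z 0 ∈ Set.Ioo (1 / 2 : ℝ) 1} ⊆ r.domain := fun z hz => by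
    rw [hr.1]; exact ⟨by linarith [hz.1], hz.2⟩
  have hsplit := split_half r hr.1 hA hB
  -- the first half
  have h1 : KZ.of (r.restrict {z : Fin 1 → ℝ | z 0 ∈ Set.Ioo (0 : ℝ) (1 / 2)}
      (by simpa using isSemialgebraic_Ioo 0 (1 / 2)) hA) - KZ.of r₁ ∈ M₁ := by
    refine reparam_move (p := 0) (q := 1 / 2) (fun u => smoothStep (2 * u))
      (fun u => 6 * (2 * u) * (1 - 2 * u) * 2)
      (isSemialgebraicFunOn_smoothStep_two_mul (by simpa using isSemialgebraic_Ioo 0 (1 / 2)))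
      (isSemialgebraicFunOn_deriv_smoothStep_two_mul (by simpa using isSemialgebraic_Ioo 0 (1 / 2)))
      (fun t _ => hasDerivAt_smoothStep_two_mul t)
      (fun t ht => ?_) image_smoothStep_two_mul γ₁ ω b (γ₁.concat γ₂ hj).toFun (fun u hu => ?_) _ r₁
      rfl (fun z hz => hr.2 z (hA hz)) hr₁
    · have h1 : 0 < 2 * t := by linarith [ht.1]
      have h2 : 0 < 1 - 2 * t := by linarith [ht.2]
      positivity
    · rw [CurvePath.concat_apply, if_pos hu.2.le]
  -- the second half
  have h2 : KZ.of (r.restrict {z : Fin 1 → ℝ | z 0 ∈ Set.Ioo (1 / 2 : ℝ) 1}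
      (by simpa using isSemialgebraic_Ioo (1 / 2) 1) hB) - KZ.of r₂ ∈ M₁ := by
    refine reparam_move (p := 1 / 2) (q := 1) (fun u => smoothStep (2 * u - 1))
      (fun u => 6 * (2 * u - 1) * (1 - (2 * u - 1)) * 2)
      (isSemialgebraicFunOn_smoothStep_two_mul_sub_one (by simpa using isSemialgebraic_Ioo (1 / 2) 1))
      (isSemialgebraicFunOn_deriv_smoothStep_two_mul_sub_one (by simpa using isSemialgebraic_Ioo (1 / 2) 1))
      (fun t _ => hasDerivAt_smoothStep_two_mul_sub_one t)
      (fun t ht => ?_) image_smoothStep_two_mul_sub_one γ₂ ω b (γ₁.concat γ₂ hj).toFun (fun u hu => ?_)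
      _ r₂ rfl (fun z hz => hr.2 z (hB hz)) hr₂
    · have h1 : 0 < 2 * t - 1 := by linarith [ht.1]
      have h2 : 0 < 1 - (2 * t - 1) := by linarith [ht.2]
      positivity
    · rw [CurvePath.concat_apply, if_neg (not_le.mpr hu.1)]
  have h := M₁.add_mem (M₁.add_mem hsplit h1) h2
  have he : ∀ (x a c y w : KZ.FormalRep), x - a - c + (a - y) + (c - w) = x - y - w := fun _ _ _ _ _ => by abel
  rwa [he] at h

/-! ## §2 Semialgebraicity -/

/-- **The unit path `t ↦ t` of `𝔸¹` is semialgebraic** (its realification is `t ↦ (t, 0)`).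
[folklore] -/
theorem isSAPath_unitPath :
    IsSemialgebraicMapOn ℚ {z : Fin 1 → ℝ | z 0 ∈ Set.Icc (0 : ℝ) 1}
      (fun z => Fin.append (fun i => (unitPath.toFun (z 0) i).re) (fun i => (unitPath.toFun (z 0) i).im)) := by
  have hdom := Realises.isSemialgebraic_IccDom
  refine IsSemialgebraicMapOn.of_forall hdom fun k => ?_
  refine Fin.addCases (fun j => ?_) (fun j => ?_) k
  · refine ((isSemialgebraicFunOn_aeval hdom (MvPolynomial.X 0)).congr fun z _ => ?_)
    rw [Fin.append_left]
    simp [unitPath]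
  · refine ((Summit.KontsevichZagierPeriods.SymplecticScissors.RealOnePeriodRelationsNegative.isSemialgebraicFunOn_ratConst
      hdom 0).congr fun z _ => ?_)
    rw [Fin.append_right]
    simp [unitPath]

/-! ## §3 Homotopies of concatenations -/

/-- **Concatenation respects the homotopy predicate** (`Path.Homotopic.hcomp` through
`CurvePeriods.exists_path_concat`). [cite: HuberWustholz2022, §3.3.1] -/
theorem homotopic_concat {γ₁ γ₁' γ₂ γ₂' : CurvePath Z} (hj : γ₁.toFun 1 = γ₂.toFun 0)
    (hj' : γ₁'.toFun 1 = γ₂'.toFun 0)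
    (h₁ : ∃ (x y : Z.points) (p p' : Path x y), (∀ t : I, γ₁.toFun t = p t) ∧
      (∀ t : I, γ₁'.toFun t = p' t) ∧ p.Homotopic p')
    (h₂ : ∃ (x y : Z.points) (p p' : Path x y), (∀ t : I, γ₂.toFun t = p t) ∧
      (∀ t : I, γ₂'.toFun t = p' t) ∧ p.Homotopic p') :
    ∃ (x y : Z.points) (p p' : Path x y), (∀ t : I, (γ₁.concat γ₂ hj).toFun t = p t) ∧
      (∀ t : I, (γ₁'.concat γ₂' hj').toFun t = p' t) ∧ p.Homotopic p' := by
  obtain ⟨x, y, p, p', hp, hp', hh⟩ := h₁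
  obtain ⟨y', z, q, q', hq, hq', hh'⟩ := h₂
  have hy : y' = y := by
    apply Subtype.ext
    have h1 := hq 0
    have h2 := hp 1
    rw [Set.Icc.coe_zero, Path.source] at h1
    rw [Set.Icc.coe_one, Path.target] at h2
    rw [← h1, ← h2, hj]
  subst hy
  obtain ⟨P, hP, hPh⟩ := exists_path_concat p q γ₁ γ₂ hj hp hq
  obtain ⟨P', hP', hP'h⟩ := exists_path_concat p' q' γ₁' γ₂' hj' hp' hq'
  exact ⟨x, z, P, P', hP, hP', hPh.trans ((hh.hcomp hh').trans hP'h.symm)⟩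

/-- **The edges of a continuous triangle**: if `τ : Δ → Z(ℂ)` is continuous on the standard
triangle and the `C¹` paths `e₀₁, e₁₂, e₀₂` agree on `[0,1]` with `τ(t,0)`, `τ(1−t,t)`, `τ(0,t)`,
then `e₀₂ ≃ e₀₁ ⋆ e₁₂` (the homotopy `τ((1 − s)(0, t) + s · brokenEdgePath t)` of
`CurvePeriods.span_boundary_of_continuousTriangle`). [cite: HuberWustholz2022, §3.3.1] -/
theorem homotopic_triangle (τ : ℝ × ℝ → (Fin Z.n → ℂ)) (hτ : ContinuousOn τ stdTriangle)
    (hτZ : MapsTo τ stdTriangle Z.points) (e₀₁ e₁₂ e₀₂ : CurvePath Z)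
    (h₀₁ : ∀ t ∈ Icc (0 : ℝ) 1, e₀₁.toFun t = τ (t, 0))
    (h₁₂ : ∀ t ∈ Icc (0 : ℝ) 1, e₁₂.toFun t = τ (1 - t, t))
    (h₀₂ : ∀ t ∈ Icc (0 : ℝ) 1, e₀₂.toFun t = τ (0, t)) (hj : e₀₁.toFun 1 = e₁₂.toFun 0) :
    ∃ (x y : Z.points) (p p' : Path x y), (∀ t : I, e₀₂.toFun t = p t) ∧
      (∀ t : I, (e₀₁.concat e₁₂ hj).toFun t = p' t) ∧ p.Homotopic p' := by
  -- the homotopy `τ((1 − s)(0, t) + s · brokenEdgePath t)`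
  let L : ℝ × ℝ → ℝ × ℝ := fun q => (1 - q.1) • ((0 : ℝ), q.2) + q.1 • brokenEdgePath q.2
  have hLc : Continuous L :=
    ((continuous_const.sub continuous_fst).smul (continuous_const.prodMk continuous_snd)).add
      (continuous_fst.smul (continuous_brokenEdgePath.comp continuous_snd))
  have hLT : MapsTo L (Icc (0 : ℝ) 1 ×ˢ Icc (0 : ℝ) 1) stdTriangle := fun q hq => by
    have hx : ((0 : ℝ), q.2) ∈ stdTriangle :=
      ⟨le_rfl, hq.2.1, show (0 : ℝ) + q.2 ≤ 1 by linarith [hq.2.2]⟩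
    exact convex_stdTriangle hx (brokenEdgePath_mem hq.2) (by linarith [hq.1.2]) hq.1.1 (by ring)
  have hL0 : ∀ s, L (s, 0) = (0, 0) := fun s => by
    show (1 - s) • ((0 : ℝ), (0 : ℝ)) + s • brokenEdgePath 0 = (0, 0)
    rw [brokenEdgePath, if_pos (by norm_num), mul_zero, smoothStep_zero]
    simp
  have hL1 : ∀ s, L (s, 1) = (0, 1) := fun s => by
    show (1 - s) • ((0 : ℝ), (1 : ℝ)) + s • brokenEdgePath 1 = (0, 1)
    rw [brokenEdgePath, if_neg (by norm_num), show (2 : ℝ) * 1 - 1 = 1 by norm_num, smoothStep_one]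
    ext <;> simp
  have hL0t : ∀ t, L (0, t) = (0, t) := fun t => by
    show (1 - 0) • ((0 : ℝ), t) + (0 : ℝ) • brokenEdgePath t = (0, t)
    simp
  have hL1t : ∀ t, L (1, t) = brokenEdgePath t := fun t => by
    show (1 - 1) • ((0 : ℝ), t) + (1 : ℝ) • brokenEdgePath t = brokenEdgePath t
    simp
  refine RetractionPaths.homotopic_of_continuousHomotopy (fun q => τ (L q))
    (hτ.comp hLc.continuousOn hLT) (fun q hq => hτZ (hLT hq))
    (fun s _ => by show τ (L (s, 0)) = τ (L (0, 0)); rw [hL0, hL0])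
    (fun s _ => by show τ (L (s, 1)) = τ (L (0, 1)); rw [hL1, hL1])
    e₀₂ (e₀₁.concat e₁₂ hj) (fun t ht => by show e₀₂.toFun t = τ (L (0, t)); rw [hL0t, h₀₂ t ht])
    (fun t ht => ?_)
  show (e₀₁.concat e₁₂ hj).toFun t = τ (L (1, t))
  rw [hL1t, CurvePath.concat_apply, brokenEdgePath]
  split_ifs with hle
  · exact h₀₁ _ (mapsTo_smoothStep (two_mul_mem_Icc ⟨ht.1, hle⟩))
  · exact h₁₂ _ (mapsTo_smoothStep (two_mul_sub_one_mem_Icc ⟨(not_le.mp hle).le, ht.2⟩))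

end RetractionConcat

/-- HELPER ANCHOR of this file (registered on stmt-KontsevichZagierPeriods-10042): the unit path of
`𝔸¹` is semialgebraic. [folklore] -/
theorem helper_retractionConcat_unitPath : IsSemialgebraicMapOn ℚ {z : Fin 1 → ℝ | z 0 ∈ Set.Icc (0 : ℝ) 1} (fun z => Fin.append (fun i => (unitPath.toFun (z 0) i).re) (fun i => (unitPath.toFun (z 0) i).im)) :=
  RetractionConcat.isSAPath_unitPath

end Summit.KontsevichZagierPeriods.SymplecticScissors.RealOnePeriodRelations

end
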